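/-
Origin: expansion seat `prover-pub-hodgecm-mc-sinst-1-g3-0`, handover #1213 2026-08-20T05:58Z md5 1aedf3b7e3c5 (371 l.) NEW additive drop-alone leaf after RUN-41 #1208 #1210 (sinst-1, landed) + installed ArchTypeReadOff; the (J-μ) READ-OFF ADAPTER in big-pair currency: cmLineTensorFin_ne_zero / cmConjLineTensorFin_ne_zero (see-saw tensor of non-zero test functions ≠ 0: Weil operator + reindexings of a non-zero box tensor), slotType_eq_of_planeTorus_eigen / _conjPlaneTorus_ (if the big pair's (conjugated) plane torus acts on φ_N₀(Φ₀) ⊗″ φ_N₁(Φ₁) by archWeight m₀ t₀ · archWeight m₁ t₁ for ANY integer tables then slotType (slotChiₖ·cₖ) = mₖ), slotType_sub_eq_… (differences), and §3 slotTypeVec_sub_eq_of_planeTorus_eigen / slotTypeVec_sub_eq_of_conjPlaneTorus_eigen = LITERALLY the left-hand sides of #1212's guarded hΔₖ binders at (F1)'s slot vectors φ_N(linePhi) (line_hctr discharges the centre eigen-characters); independent of #1212; install AFTER #1208 #1210 (landed); drop alone on bounce; NAME LIST: HodgeCM.Model.ArchSideTerm.cmLineTensorFin_ne_zero · HodgeCM.Model.ArchSideTerm.slotType_eq_of_planeTorus_eigen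 · HodgeCM.Model.ArchSideTerm.slotType_sub_eq_of_planeTorus_eigen · HodgeCM.Model.ArchSideTerm.cmConjLineTensorFin_ne_zero · HodgeCM.Model.ArchSideTerm.slotType_eq_of_conjPlaneTorus_eigen · HodgeCM.Model.ArchSideTerm.slotType_sub_eq_of_conjPlaneTorus_eigen · HodgeCM.Model.ArchSideTerm.slotTypeVec_sub_eq_of_planeTorus_eigen · HodgeCM.Model.ArchSideTerm.slotTypeVec_sub_eq_of_conjPlaneTorus_eigen (`HOME/mc/pub-hodgecm-mc-sinst-1-g3/stage/HodgeCM/Model/ArchLineSlotTypeEigen.lean`, md5 1aedf3b7e3c5, 371 lines);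
landed by the second packager p2 gen 3 (p2-g3) in gate run 42 as `HodgeCM/Model/ArchLineSlotTypeEigen.lean` (verbatim).
-/
/-
Origin: speedrun cell pub-hodgecm, MODEL-CONSTRUCTION sub-cell, lineage mc-sinst-1 (S-instance constructor, BINDER-OWNERS row 5 `S` / row 6 `μ`: (J-μ)),
seat prover-pub-hodgecm-mc-sinst-1-g3-0 (gen 3), 2026-08-20.  Target in PKG: `HodgeCM/Model/ArchLineSlotTypeEigen.lean`
(NEW additive drop-alone leaf; RUN 42 material; imports RUN-41 #1210 `Model/ArchLineSlotTypeSeesaw` + #1208 `Model/ArchLineSlotTypeCont` + installed `Model/ArchTypeReadOff`).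
KERNEL only: 0 records / `def … : Prop` / cites, 0 proof holes; intended closure {propext, Classical.choice, Quot.sound}.
-/
import Summits.HodgeConjecture.HodgeCM.Model.ArchLineSlotTypeSeesaw
import Summits.HodgeConjecture.HodgeCM.Model.ArchTypeReadOff
import Summits.HodgeConjecture.HodgeCM.Model.ArchLineSlotTypeCont_2

/-!
# (J-μ) READ-OFF ADAPTER: slot types from ONE eigen-identity of the BIG pair's plane torus

#1210 identified the slot characters `slotChiₖ · cₖ` with the eigenvalues of the big pair's plane torus `(1, diag(t₀,t₁))`
(resp. conjugated-plane torus) on the see-saw tensor `φ_{N₀}(Φ₀) ⊗″ φ_{N₁}(Φ₁)` of the slot test functions.  This leaf turns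
that identification into the ADAPTER binder-2 ∕ theta-3's closed forms plug into:

* `cmLineTensorFin_ne_zero`, `cmConjLineTensorFin_ne_zero` — the see-saw tensor of non-zero test functions is non-zero
  (`⊗″ = R_e ∘ ω(see-saw element) ∘ R⁻¹ ∘ ⊠`: a Weil operator and reindexings of a non-zero box tensor);
* **`slotType_eq_of_planeTorus_eigen`** / **`slotType_eq_of_conjPlaneTorus_eigen`**: if the big pair's plane torus acts on
  the see-saw tensor of the slot test functions by `archWeight m₀ t₀ · archWeight m₁ t₁` (ANY integer tables `m₀ m₁`, e.g.
  binder-2's letter-exponent tables of the PAIR splitting — individually choice-laden, only their difference closed), then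
  `slotType (slotChi₀·c₀) = m₀` and `slotType (slotChi₁·c₁) = m₁` (likewise slots 2, 3);
* **`slotType_sub_eq_of_planeTorus_eigen`** (+ conj twin): hence the (J-μ) residual `slotType₁ − slotType₀ = m₁ − m₀`;
* § 3 **`slotTypeVec_sub_eq_of_planeTorus_eigen`**, **`slotTypeVec_sub_eq_of_conjPlaneTorus_eigen`**: the same at (F1)'s own slot
  vectors `φ_N(linePhi)` (centre eigen-characters `lineCHom`, discharged by `line_hctr`) — LITERALLY the left-hand sides of the guarded
  binders `hΔₖ` of `SInstance.SR/SROG` (#1212): `hΔₖ` follows once `mₖ − m₀ = μ c k − μ c 0` is E's table.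
Nothing here is a claim of PerL/QW8; kernel analysis over the tree's constructed objects.
-/

set_option autoImplicit false

noncomputable section

open scoped Matrix Classical SchwartzMap
open Literature.NumberTheory.Automorphic Literature.NumberTheory.Weil1964
open Literature.NumberTheory.GelbartRogawski1991.UnitaryDualPair
open HodgeCM.Adelic HodgeCM.PerL34

namespace HodgeCM.Model.ArchSideTerm

/-- a representation operator kills no non-zero vector. -/
private theorem rep_apply_ne_zero {k G W : Type*} [CommSemiring k] [Group G] [AddCommMonoid W] [Module k W]
    (ρ : Representation k G W) (g : G) {v : W} (hv : v ≠ 0) : ρ g v ≠ 0 := fun h => hv <| by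
  have h' := congrArg (ρ g⁻¹) h
  rwa [map_zero, ← Module.End.mul_apply, ← map_mul, inv_mul_cancel, map_one, Module.End.one_apply] at h'

section Plane

variable {L : CMField} {ι₁ : L →+* ℂ} (V : HermSpace3 L ι₁) (S : StubTree.SeesawDatum L)
variable
  (hGR : (cmSplittingDatum (L : Type) finProdFinEquiv (frameD V) (frameD_real V) (frameD_ne V) (dW S) (dW_real S) (dW_ne S)).CompatibleSplitting)
  (hGR₀ : (cmSplittingDatum (L : Type) (e₁) (frameD V) (frameD_real V) (frameD_ne V) (lineVec (L : Type) (dW S 0))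
    (fun _ => dW_real S 0) (fun _ => dW_ne S 0)).CompatibleSplitting)
  (hGR₁ : (cmSplittingDatum (L : Type) (e₁) (frameD V) (frameD_real V) (frameD_ne V) (lineVec (L : Type) (dW S 1))
    (fun _ => dW_real S 1) (fun _ => dW_ne S 1)).CompatibleSplitting)

/-- **the see-saw tensor `φ₀ ⊗″ φ₁` of non-zero test functions is non-zero.** -/
theorem cmLineTensorFin_ne_zero {φ₀ φ₁ : piSchwartzBruhat (↥(NumberField.maximalRealSubfield (L : Type))) (Fin 3)} (h₀ : φ₀ ≠ 0) (h₁ : φ₁ ≠ 0) :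
    cmLineTensorFin (L : Type) finProdFinEquiv e₁ (frameD V) (frameD_real V) (frameD_ne V) (dW S) (dW_real S) (dW_ne S) φ₀ φ₁ ≠ 0 := by
  rw [cmLineTensorFin_apply, cmLineTensor, seesawConjTensor_apply]
  exact (LinearEquiv.map_ne_zero_iff _).2 (rep_apply_ne_zero _ _ ((LinearEquiv.map_ne_zero_iff _).2
    (tensorToSum_ne_zero ((LinearEquiv.map_ne_zero_iff _).2 h₀) ((LinearEquiv.map_ne_zero_iff _).2 h₁))))

/-- **READ-OFF OF BOTH PLANE SLOT TYPES from one eigen-identity of the big pair's plane torus** on the see-saw tensor of the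
slot test functions (ANY tables `m₀ m₁`; `cₖ` the slots' centre eigen-characters as in #1210 / `ArchLineDatum.hctrₖ`). -/
theorem slotType_eq_of_planeTorus_eigen
    (Φ₀ Φ₁ : SchwartzMap (Fin 3 → NumberField.mixedEmbedding.mixedSpace (↥(NumberField.maximalRealSubfield (L : Type)))) ℂ)
    (x₀ x₁ : Fin 3 → ↥(NumberField.maximalRealSubfield (L : Type)))
    (c₀ c₁ : ↥(relNormOneInfUnits (↥(NumberField.maximalRealSubfield (L : Type))) (L : Type)) →* ℂ)
    (hctr₀ : ∀ (N : ℕ) (t : ↥(relNormOneInfUnits (↥(NumberField.maximalRealSubfield (L : Type))) (L : Type))),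
      cmPairRep (L : Type) e₁ (frameD V) (frameD_real V) (frameD_ne V) (lineVec (L : Type) (dW S 0)) (fun _ => dW_real S 0)
          (fun _ => dW_ne S 0) hGR₀
          (CMCenter (L : Type) (frameD V)
              ((UnitaryGroup.cmAdelicOneEquivRelNormOne (L : Type)).symm (relNormOneInfToIdeles (↥(NumberField.maximalRealSubfield (L : Type))) (L : Type) t)), 1)
          (SupplyInstance.testFun (↥(NumberField.maximalRealSubfield (L : Type))) (Fin 3) Φ₀ x₀ N) =
        c₀ t • SupplyInstance.testFun (↥(NumberField.maximalRealSubfield (L : Type))) (Fin 3) Φ₀ x₀ N)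
    (hctr₁ : ∀ (N : ℕ) (t : ↥(relNormOneInfUnits (↥(NumberField.maximalRealSubfield (L : Type))) (L : Type))),
      cmPairRep (L : Type) e₁ (frameD V) (frameD_real V) (frameD_ne V) (lineVec (L : Type) (dW S 1)) (fun _ => dW_real S 1)
          (fun _ => dW_ne S 1) hGR₁
          (CMCenter (L : Type) (frameD V)
              ((UnitaryGroup.cmAdelicOneEquivRelNormOne (L : Type)).symm (relNormOneInfToIdeles (↥(NumberField.maximalRealSubfield (L : Type))) (L : Type) t)), 1)
          (SupplyInstance.testFun (↥(NumberField.maximalRealSubfield (L : Type))) (Fin 3) Φ₁ x₁ N) =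
        c₁ t • SupplyInstance.testFun (↥(NumberField.maximalRealSubfield (L : Type))) (Fin 3) Φ₁ x₁ N)
    (hχ₀ : Continuous ⇑(slotChi₀ V S hGR hGR₀ hGR₁ * c₀)) (hχ₁ : Continuous ⇑(slotChi₁ V S hGR hGR₀ hGR₁ * c₁))
    (hx₀ : Φ₀ (SupplyInstance.archEmb (↥(NumberField.maximalRealSubfield (L : Type))) (Fin 3) x₀) ≠ 0) (hx₁ : Φ₁ (SupplyInstance.archEmb (↥(NumberField.maximalRealSubfield (L : Type))) (Fin 3) x₁) ≠ 0)
    {N₀ N₁ : ℕ} (hN₀ : N₀ ≠ 0) (hN₁ : N₁ ≠ 0) (m₀ m₁ : NumberField.InfinitePlace (L : Type) → ℤ)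
    (h : ∀ t₀ t₁ : ↥(relNormOneInfUnits (↥(NumberField.maximalRealSubfield (L : Type))) (L : Type)),
      cmPairRep (L : Type) finProdFinEquiv (frameD V) (frameD_real V) (frameD_ne V) (dW S) (dW_real S) (dW_ne S) hGR
        (1, cmPlaneTorusIdeles (L : Type) (dW S)
          (relNormOneInfToIdeles (↥(NumberField.maximalRealSubfield (L : Type))) (L : Type) t₀,
            relNormOneInfToIdeles (↥(NumberField.maximalRealSubfield (L : Type))) (L : Type) t₁))
    (cmLineTensorFin (L : Type) finProdFinEquiv e₁ (frameD V) (frameD_real V) (frameD_ne V) (dW S) (dW_real S) (dW_ne S)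
          (SupplyInstance.testFun (↥(NumberField.maximalRealSubfield (L : Type))) (Fin 3) Φ₀ x₀ N₀)
          (SupplyInstance.testFun (↥(NumberField.maximalRealSubfield (L : Type))) (Fin 3) Φ₁ x₁ N₁)) =
      (archWeight (L : Type) m₀ t₀ * archWeight (L : Type) m₁ t₁) •
    (cmLineTensorFin (L : Type) finProdFinEquiv e₁ (frameD V) (frameD_real V) (frameD_ne V) (dW S) (dW_real S) (dW_ne S)
          (SupplyInstance.testFun (↥(NumberField.maximalRealSubfield (L : Type))) (Fin 3) Φ₀ x₀ N₀)
          (SupplyInstance.testFun (↥(NumberField.maximalRealSubfield (L : Type))) (Fin 3) Φ₁ x₁ N₁))) :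
    slotType (L := L) (slotChi₀ V S hGR hGR₀ hGR₁ * c₀) hχ₀ = m₀ ∧ slotType (L := L) (slotChi₁ V S hGR hGR₀ hGR₁ * c₁) hχ₁ = m₁ := by
  have hX :
    (cmLineTensorFin (L : Type) finProdFinEquiv e₁ (frameD V) (frameD_real V) (frameD_ne V) (dW S) (dW_real S) (dW_ne S)
          (SupplyInstance.testFun (↥(NumberField.maximalRealSubfield (L : Type))) (Fin 3) Φ₀ x₀ N₀)
          (SupplyInstance.testFun (↥(NumberField.maximalRealSubfield (L : Type))) (Fin 3) Φ₁ x₁ N₁)) ≠ 0 :=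
    cmLineTensorFin_ne_zero V S (testFun_ne_zero Φ₀ hx₀ hN₀) (testFun_ne_zero Φ₁ hx₁ hN₁)
  have key : ∀ t₀ t₁ : ↥(relNormOneInfUnits (↥(NumberField.maximalRealSubfield (L : Type))) (L : Type)),
      (slotChi₀ V S hGR hGR₀ hGR₁ * c₀) t₀ * (slotChi₁ V S hGR hGR₀ hGR₁ * c₁) t₁ =
        archWeight (L : Type) m₀ t₀ * archWeight (L : Type) m₁ t₁ := fun t₀ t₁ =>
    smul_left_injective ℂ hX
      ((cmPairRep_planeTorus_lineTensorFin_testFun V S hGR hGR₀ hGR₁ Φ₀ Φ₁ x₀ x₁ c₀ c₁ hctr₀ hctr₁ N₀ N₁ t₀ t₁).symm.trans (h t₀ t₁))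
  refine ⟨(charArchType_eq_iff (L : Type) _ hχ₀ m₀).2 (MonoidHom.ext fun t => ?_),
    (charArchType_eq_iff (L : Type) _ hχ₁ m₁).2 (MonoidHom.ext fun t => ?_)⟩
  · have h1 := key t 1
    rwa [map_one, map_one, mul_one, mul_one, eq_comm] at h1
  · have h1 := key 1 t
    rwa [map_one, map_one, one_mul, one_mul, eq_comm] at h1

/-- **the (J-μ) residual for slot 1 in big-pair currency**: `slotType₁ − slotType₀ = m₁ − m₀`. -/
theorem slotType_sub_eq_of_planeTorus_eigen
    (Φ₀ Φ₁ : SchwartzMap (Fin 3 → NumberField.mixedEmbedding.mixedSpace (↥(NumberField.maximalRealSubfield (L : Type)))) ℂ)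
    (x₀ x₁ : Fin 3 → ↥(NumberField.maximalRealSubfield (L : Type)))
    (c₀ c₁ : ↥(relNormOneInfUnits (↥(NumberField.maximalRealSubfield (L : Type))) (L : Type)) →* ℂ)
    (hctr₀ : ∀ (N : ℕ) (t : ↥(relNormOneInfUnits (↥(NumberField.maximalRealSubfield (L : Type))) (L : Type))),
      cmPairRep (L : Type) e₁ (frameD V) (frameD_real V) (frameD_ne V) (lineVec (L : Type) (dW S 0)) (fun _ => dW_real S 0)
          (fun _ => dW_ne S 0) hGR₀
          (CMCenter (L : Type) (frameD V)
              ((UnitaryGroup.cmAdelicOneEquivRelNormOne (L : Type)).symm (relNormOneInfToIdeles (↥(NumberField.maximalRealSubfield (L : Type))) (L : Type) t)), 1)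
          (SupplyInstance.testFun (↥(NumberField.maximalRealSubfield (L : Type))) (Fin 3) Φ₀ x₀ N) =
        c₀ t • SupplyInstance.testFun (↥(NumberField.maximalRealSubfield (L : Type))) (Fin 3) Φ₀ x₀ N)
    (hctr₁ : ∀ (N : ℕ) (t : ↥(relNormOneInfUnits (↥(NumberField.maximalRealSubfield (L : Type))) (L : Type))),
      cmPairRep (L : Type) e₁ (frameD V) (frameD_real V) (frameD_ne V) (lineVec (L : Type) (dW S 1)) (fun _ => dW_real S 1)
          (fun _ => dW_ne S 1) hGR₁
          (CMCenter (L : Type) (frameD V)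
              ((UnitaryGroup.cmAdelicOneEquivRelNormOne (L : Type)).symm (relNormOneInfToIdeles (↥(NumberField.maximalRealSubfield (L : Type))) (L : Type) t)), 1)
          (SupplyInstance.testFun (↥(NumberField.maximalRealSubfield (L : Type))) (Fin 3) Φ₁ x₁ N) =
        c₁ t • SupplyInstance.testFun (↥(NumberField.maximalRealSubfield (L : Type))) (Fin 3) Φ₁ x₁ N)
    (hχ₀ : Continuous ⇑(slotChi₀ V S hGR hGR₀ hGR₁ * c₀)) (hχ₁ : Continuous ⇑(slotChi₁ V S hGR hGR₀ hGR₁ * c₁))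
    (hx₀ : Φ₀ (SupplyInstance.archEmb (↥(NumberField.maximalRealSubfield (L : Type))) (Fin 3) x₀) ≠ 0) (hx₁ : Φ₁ (SupplyInstance.archEmb (↥(NumberField.maximalRealSubfield (L : Type))) (Fin 3) x₁) ≠ 0)
    {N₀ N₁ : ℕ} (hN₀ : N₀ ≠ 0) (hN₁ : N₁ ≠ 0) (m₀ m₁ : NumberField.InfinitePlace (L : Type) → ℤ)
    (h : ∀ t₀ t₁ : ↥(relNormOneInfUnits (↥(NumberField.maximalRealSubfield (L : Type))) (L : Type)),
      cmPairRep (L : Type) finProdFinEquiv (frameD V) (frameD_real V) (frameD_ne V) (dW S) (dW_real S) (dW_ne S) hGR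
        (1, cmPlaneTorusIdeles (L : Type) (dW S)
          (relNormOneInfToIdeles (↥(NumberField.maximalRealSubfield (L : Type))) (L : Type) t₀,
            relNormOneInfToIdeles (↥(NumberField.maximalRealSubfield (L : Type))) (L : Type) t₁))
    (cmLineTensorFin (L : Type) finProdFinEquiv e₁ (frameD V) (frameD_real V) (frameD_ne V) (dW S) (dW_real S) (dW_ne S)
          (SupplyInstance.testFun (↥(NumberField.maximalRealSubfield (L : Type))) (Fin 3) Φ₀ x₀ N₀)
          (SupplyInstance.testFun (↥(NumberField.maximalRealSubfield (L : Type))) (Fin 3) Φ₁ x₁ N₁)) =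
      (archWeight (L : Type) m₀ t₀ * archWeight (L : Type) m₁ t₁) •
    (cmLineTensorFin (L : Type) finProdFinEquiv e₁ (frameD V) (frameD_real V) (frameD_ne V) (dW S) (dW_real S) (dW_ne S)
          (SupplyInstance.testFun (↥(NumberField.maximalRealSubfield (L : Type))) (Fin 3) Φ₀ x₀ N₀)
          (SupplyInstance.testFun (↥(NumberField.maximalRealSubfield (L : Type))) (Fin 3) Φ₁ x₁ N₁))) :
    slotType (L := L) (slotChi₁ V S hGR hGR₀ hGR₁ * c₁) hχ₁ - slotType (L := L) (slotChi₀ V S hGR hGR₀ hGR₁ * c₀) hχ₀ = m₁ - m₀ := by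
  obtain ⟨h₀, h₁⟩ := slotType_eq_of_planeTorus_eigen V S hGR hGR₀ hGR₁ Φ₀ Φ₁ x₀ x₁ c₀ c₁ hctr₀ hctr₁ hχ₀ hχ₁ hx₀ hx₁ hN₀ hN₁ m₀ m₁ h
  rw [h₀, h₁]

end Plane

section ConjPlane

variable {L : CMField} {ι₁ : L →+* ℂ} (V : HermSpace3 L ι₁) (S : StubTree.SeesawDatum L)
variable
  (hGR : (cmSplittingDatum (L : Type) finProdFinEquiv (frameD V) (frameD_real V) (frameD_ne V) (dW S) (dW_real S) (dW_ne S)).CompatibleSplitting)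
  (hGR₂ : (cmSplittingDatum (L : Type) (e₁) (frameD V) (frameD_real V) (frameD_ne V) (lineVec (L : Type) (dW' S 0))
    (fun _ => dW'_real S 0) (fun _ => dW'_ne S 0)).CompatibleSplitting)
  (hGR₃ : (cmSplittingDatum (L : Type) (e₁) (frameD V) (frameD_real V) (frameD_ne V) (lineVec (L : Type) (dW' S 1))
    (fun _ => dW'_real S 1) (fun _ => dW'_ne S 1)).CompatibleSplitting)

/-- **the conjugated see-saw tensor of non-zero test functions is non-zero.** -/
theorem cmConjLineTensorFin_ne_zero {φ₂ φ₃ : piSchwartzBruhat (↥(NumberField.maximalRealSubfield (L : Type))) (Fin 3)} (h₂ : φ₂ ≠ 0) (h₃ : φ₃ ≠ 0) :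
    cmConjLineTensorFin (L : Type) finProdFinEquiv e₁ (frameD V) (frameD_real V) (frameD_ne V) (dW S) (dW_real S) (dW_ne S)
      (dW' S) (dW'_real S) (dW'_ne S) S.isoGL (isoGL_hg₀ S) φ₂ φ₃ ≠ 0 := by
  rw [cmConjLineTensorFin_apply, cmConjLineTensor, seesawConjTensor_apply]
  exact (LinearEquiv.map_ne_zero_iff _).2 (rep_apply_ne_zero _ _ ((LinearEquiv.map_ne_zero_iff _).2
    (tensorToSum_ne_zero ((LinearEquiv.map_ne_zero_iff _).2 h₂) ((LinearEquiv.map_ne_zero_iff _).2 h₃))))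

/-- **READ-OFF OF BOTH CONJUGATED-PLANE SLOT TYPES** (slots 2, 3) from one eigen-identity of the conjugated plane torus. -/
theorem slotType_eq_of_conjPlaneTorus_eigen
    (Φ₂ Φ₃ : SchwartzMap (Fin 3 → NumberField.mixedEmbedding.mixedSpace (↥(NumberField.maximalRealSubfield (L : Type)))) ℂ)
    (x₂ x₃ : Fin 3 → ↥(NumberField.maximalRealSubfield (L : Type)))
    (c₂ c₃ : ↥(relNormOneInfUnits (↥(NumberField.maximalRealSubfield (L : Type))) (L : Type)) →* ℂ)
    (hctr₂ : ∀ (N : ℕ) (t : ↥(relNormOneInfUnits (↥(NumberField.maximalRealSubfield (L : Type))) (L : Type))),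
      cmPairRep (L : Type) e₁ (frameD V) (frameD_real V) (frameD_ne V) (lineVec (L : Type) (dW' S 0)) (fun _ => dW'_real S 0)
          (fun _ => dW'_ne S 0) hGR₂
          (CMCenter (L : Type) (frameD V) ((UnitaryGroup.cmAdelicOneEquivRelNormOne (L : Type)).symm (relNormOneInfToIdeles (↥(NumberField.maximalRealSubfield (L : Type))) (L : Type) t)), 1)
          (SupplyInstance.testFun (↥(NumberField.maximalRealSubfield (L : Type))) (Fin 3) Φ₂ x₂ N) =
        c₂ t • SupplyInstance.testFun (↥(NumberField.maximalRealSubfield (L : Type))) (Fin 3) Φ₂ x₂ N)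
    (hctr₃ : ∀ (N : ℕ) (t : ↥(relNormOneInfUnits (↥(NumberField.maximalRealSubfield (L : Type))) (L : Type))),
      cmPairRep (L : Type) e₁ (frameD V) (frameD_real V) (frameD_ne V) (lineVec (L : Type) (dW' S 1)) (fun _ => dW'_real S 1)
          (fun _ => dW'_ne S 1) hGR₃
          (CMCenter (L : Type) (frameD V) ((UnitaryGroup.cmAdelicOneEquivRelNormOne (L : Type)).symm (relNormOneInfToIdeles (↥(NumberField.maximalRealSubfield (L : Type))) (L : Type) t)), 1)
          (SupplyInstance.testFun (↥(NumberField.maximalRealSubfield (L : Type))) (Fin 3) Φ₃ x₃ N) =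
        c₃ t • SupplyInstance.testFun (↥(NumberField.maximalRealSubfield (L : Type))) (Fin 3) Φ₃ x₃ N)
    (hχ₂ : Continuous ⇑(slotChi₂ V S hGR hGR₂ hGR₃ * c₂)) (hχ₃ : Continuous ⇑(slotChi₃ V S hGR hGR₂ hGR₃ * c₃))
    (hx₂ : Φ₂ (SupplyInstance.archEmb (↥(NumberField.maximalRealSubfield (L : Type))) (Fin 3) x₂) ≠ 0) (hx₃ : Φ₃ (SupplyInstance.archEmb (↥(NumberField.maximalRealSubfield (L : Type))) (Fin 3) x₃) ≠ 0)
    {N₀ N₁ : ℕ} (hN₀ : N₀ ≠ 0) (hN₁ : N₁ ≠ 0) (m₂ m₃ : NumberField.InfinitePlace (L : Type) → ℤ)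
    (h : ∀ t₀ t₁ : ↥(relNormOneInfUnits (↥(NumberField.maximalRealSubfield (L : Type))) (L : Type)),
      cmPairRep (L : Type) finProdFinEquiv (frameD V) (frameD_real V) (frameD_ne V) (dW S) (dW_real S) (dW_ne S) hGR
        (1, cmConjPlaneTorusIdeles (L : Type) (dW S) (dW' S) S.isoGL (isoGL_hg₀ S)
          (relNormOneInfToIdeles (↥(NumberField.maximalRealSubfield (L : Type))) (L : Type) t₀,
            relNormOneInfToIdeles (↥(NumberField.maximalRealSubfield (L : Type))) (L : Type) t₁))
    (cmConjLineTensorFin (L : Type) finProdFinEquiv e₁ (frameD V) (frameD_real V) (frameD_ne V) (dW S) (dW_real S) (dW_ne S)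
          (dW' S) (dW'_real S) (dW'_ne S) S.isoGL (isoGL_hg₀ S)
          (SupplyInstance.testFun (↥(NumberField.maximalRealSubfield (L : Type))) (Fin 3) Φ₂ x₂ N₀)
          (SupplyInstance.testFun (↥(NumberField.maximalRealSubfield (L : Type))) (Fin 3) Φ₃ x₃ N₁)) =
      (archWeight (L : Type) m₂ t₀ * archWeight (L : Type) m₃ t₁) •
    (cmConjLineTensorFin (L : Type) finProdFinEquiv e₁ (frameD V) (frameD_real V) (frameD_ne V) (dW S) (dW_real S) (dW_ne S)
          (dW' S) (dW'_real S) (dW'_ne S) S.isoGL (isoGL_hg₀ S)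
          (SupplyInstance.testFun (↥(NumberField.maximalRealSubfield (L : Type))) (Fin 3) Φ₂ x₂ N₀)
          (SupplyInstance.testFun (↥(NumberField.maximalRealSubfield (L : Type))) (Fin 3) Φ₃ x₃ N₁))) :
    slotType (L := L) (slotChi₂ V S hGR hGR₂ hGR₃ * c₂) hχ₂ = m₂ ∧ slotType (L := L) (slotChi₃ V S hGR hGR₂ hGR₃ * c₃) hχ₃ = m₃ := by
  have hX :
    (cmConjLineTensorFin (L : Type) finProdFinEquiv e₁ (frameD V) (frameD_real V) (frameD_ne V) (dW S) (dW_real S) (dW_ne S)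
          (dW' S) (dW'_real S) (dW'_ne S) S.isoGL (isoGL_hg₀ S)
          (SupplyInstance.testFun (↥(NumberField.maximalRealSubfield (L : Type))) (Fin 3) Φ₂ x₂ N₀)
          (SupplyInstance.testFun (↥(NumberField.maximalRealSubfield (L : Type))) (Fin 3) Φ₃ x₃ N₁)) ≠ 0 :=
    cmConjLineTensorFin_ne_zero V S (testFun_ne_zero Φ₂ hx₂ hN₀) (testFun_ne_zero Φ₃ hx₃ hN₁)
  have key : ∀ t₀ t₁ : ↥(relNormOneInfUnits (↥(NumberField.maximalRealSubfield (L : Type))) (L : Type)),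
      (slotChi₂ V S hGR hGR₂ hGR₃ * c₂) t₀ * (slotChi₃ V S hGR hGR₂ hGR₃ * c₃) t₁ =
        archWeight (L : Type) m₂ t₀ * archWeight (L : Type) m₃ t₁ := fun t₀ t₁ =>
    smul_left_injective ℂ hX
      ((cmPairRep_conjPlaneTorus_lineTensorFin_testFun V S hGR hGR₂ hGR₃ Φ₂ Φ₃ x₂ x₃ c₂ c₃ hctr₂ hctr₃ N₀ N₁ t₀ t₁).symm.trans
        (h t₀ t₁))
  refine ⟨(charArchType_eq_iff (L : Type) _ hχ₂ m₂).2 (MonoidHom.ext fun t => ?_),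
    (charArchType_eq_iff (L : Type) _ hχ₃ m₃).2 (MonoidHom.ext fun t => ?_)⟩
  · have h1 := key t 1
    rwa [map_one, map_one, mul_one, mul_one, eq_comm] at h1
  · have h1 := key 1 t
    rwa [map_one, map_one, one_mul, one_mul, eq_comm] at h1

/-- **the (J-μ) residual for slots 2, 3 in big-pair currency**, relative to slot 0's table `m₀` read off on the plane:
`slotType₂ = m₂`, `slotType₃ = m₃` give `slotTypeₖ − slotType₀ = mₖ − m₀` once `slotType₀ = m₀`. -/
theorem slotType_sub_eq_of_conjPlaneTorus_eigen
    (Φ₂ Φ₃ : SchwartzMap (Fin 3 → NumberField.mixedEmbedding.mixedSpace (↥(NumberField.maximalRealSubfield (L : Type)))) ℂ)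
    (x₂ x₃ : Fin 3 → ↥(NumberField.maximalRealSubfield (L : Type)))
    (c₂ c₃ : ↥(relNormOneInfUnits (↥(NumberField.maximalRealSubfield (L : Type))) (L : Type)) →* ℂ)
    (hctr₂ : ∀ (N : ℕ) (t : ↥(relNormOneInfUnits (↥(NumberField.maximalRealSubfield (L : Type))) (L : Type))),
      cmPairRep (L : Type) e₁ (frameD V) (frameD_real V) (frameD_ne V) (lineVec (L : Type) (dW' S 0)) (fun _ => dW'_real S 0)
          (fun _ => dW'_ne S 0) hGR₂
          (CMCenter (L : Type) (frameD V) ((UnitaryGroup.cmAdelicOneEquivRelNormOne (L : Type)).symm (relNormOneInfToIdeles (↥(NumberField.maximalRealSubfield (L : Type))) (L : Type) t)), 1)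
          (SupplyInstance.testFun (↥(NumberField.maximalRealSubfield (L : Type))) (Fin 3) Φ₂ x₂ N) =
        c₂ t • SupplyInstance.testFun (↥(NumberField.maximalRealSubfield (L : Type))) (Fin 3) Φ₂ x₂ N)
    (hctr₃ : ∀ (N : ℕ) (t : ↥(relNormOneInfUnits (↥(NumberField.maximalRealSubfield (L : Type))) (L : Type))),
      cmPairRep (L : Type) e₁ (frameD V) (frameD_real V) (frameD_ne V) (lineVec (L : Type) (dW' S 1)) (fun _ => dW'_real S 1)
          (fun _ => dW'_ne S 1) hGR₃
          (CMCenter (L : Type) (frameD V) ((UnitaryGroup.cmAdelicOneEquivRelNormOne (L : Type)).symm (relNormOneInfToIdeles (↥(NumberField.maximalRealSubfield (L : Type))) (L : Type) t)), 1)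
          (SupplyInstance.testFun (↥(NumberField.maximalRealSubfield (L : Type))) (Fin 3) Φ₃ x₃ N) =
        c₃ t • SupplyInstance.testFun (↥(NumberField.maximalRealSubfield (L : Type))) (Fin 3) Φ₃ x₃ N)
    (hχ₂ : Continuous ⇑(slotChi₂ V S hGR hGR₂ hGR₃ * c₂)) (hχ₃ : Continuous ⇑(slotChi₃ V S hGR hGR₂ hGR₃ * c₃))
    (hx₂ : Φ₂ (SupplyInstance.archEmb (↥(NumberField.maximalRealSubfield (L : Type))) (Fin 3) x₂) ≠ 0) (hx₃ : Φ₃ (SupplyInstance.archEmb (↥(NumberField.maximalRealSubfield (L : Type))) (Fin 3) x₃) ≠ 0)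
    {N₀ N₁ : ℕ} (hN₀ : N₀ ≠ 0) (hN₁ : N₁ ≠ 0) (m₂ m₃ : NumberField.InfinitePlace (L : Type) → ℤ)
    (h : ∀ t₀ t₁ : ↥(relNormOneInfUnits (↥(NumberField.maximalRealSubfield (L : Type))) (L : Type)),
      cmPairRep (L : Type) finProdFinEquiv (frameD V) (frameD_real V) (frameD_ne V) (dW S) (dW_real S) (dW_ne S) hGR
        (1, cmConjPlaneTorusIdeles (L : Type) (dW S) (dW' S) S.isoGL (isoGL_hg₀ S)
          (relNormOneInfToIdeles (↥(NumberField.maximalRealSubfield (L : Type))) (L : Type) t₀,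
            relNormOneInfToIdeles (↥(NumberField.maximalRealSubfield (L : Type))) (L : Type) t₁))
    (cmConjLineTensorFin (L : Type) finProdFinEquiv e₁ (frameD V) (frameD_real V) (frameD_ne V) (dW S) (dW_real S) (dW_ne S)
          (dW' S) (dW'_real S) (dW'_ne S) S.isoGL (isoGL_hg₀ S)
          (SupplyInstance.testFun (↥(NumberField.maximalRealSubfield (L : Type))) (Fin 3) Φ₂ x₂ N₀)
          (SupplyInstance.testFun (↥(NumberField.maximalRealSubfield (L : Type))) (Fin 3) Φ₃ x₃ N₁)) =
      (archWeight (L : Type) m₂ t₀ * archWeight (L : Type) m₃ t₁) •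
    (cmConjLineTensorFin (L : Type) finProdFinEquiv e₁ (frameD V) (frameD_real V) (frameD_ne V) (dW S) (dW_real S) (dW_ne S)
          (dW' S) (dW'_real S) (dW'_ne S) S.isoGL (isoGL_hg₀ S)
          (SupplyInstance.testFun (↥(NumberField.maximalRealSubfield (L : Type))) (Fin 3) Φ₂ x₂ N₀)
          (SupplyInstance.testFun (↥(NumberField.maximalRealSubfield (L : Type))) (Fin 3) Φ₃ x₃ N₁)))
    {χ₀ : ↥(relNormOneInfUnits (↥(NumberField.maximalRealSubfield (L : Type))) (L : Type)) →* ℂ} (hχ₀ : Continuous χ₀) {m₀ : NumberField.InfinitePlace (L : Type) → ℤ}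
    (h₀ : slotType (L := L) χ₀ hχ₀ = m₀) :
    slotType (L := L) (slotChi₂ V S hGR hGR₂ hGR₃ * c₂) hχ₂ - slotType (L := L) χ₀ hχ₀ = m₂ - m₀ ∧
      slotType (L := L) (slotChi₃ V S hGR hGR₂ hGR₃ * c₃) hχ₃ - slotType (L := L) χ₀ hχ₀ = m₃ - m₀ := by
  obtain ⟨h₂', h₃'⟩ := slotType_eq_of_conjPlaneTorus_eigen V S hGR hGR₂ hGR₃ Φ₂ Φ₃ x₂ x₃ c₂ c₃ hctr₂ hctr₃ hχ₂ hχ₃ hx₂ hx₃ hN₀ hN₁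
    m₂ m₃ h
  rw [h₀, h₂', h₃']
  exact ⟨rfl, rfl⟩

end ConjPlane

/-! ## § 3 the family-level form: `slotTypeVec k − slotTypeVec 0` (the `hΔₖ` of #1208/#1212) from the two torus eigen-identities
at (F1)'s own slot vectors `φ_N(linePhi)` (centre eigen-characters `lineCHom`, `line_hctr`) -/

section Vec

variable {L : CMField} {ι₁ : L →+* ℂ} (V : HermSpace3 L ι₁) (c : SeesawCtx L)
variable
  (hGR : (cmSplittingDatum (L : Type) finProdFinEquiv (frameD V) (frameD_real V) (frameD_ne V) (dW c.D) (dW_real c.D) (dW_ne c.D)).CompatibleSplitting)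
  (hGR₀ : (cmSplittingDatum (L : Type) (e₁) (frameD V) (frameD_real V) (frameD_ne V) (lineVec (L : Type) (dW c.D 0))
    (fun _ => dW_real c.D 0) (fun _ => dW_ne c.D 0)).CompatibleSplitting)
  (hGR₁ : (cmSplittingDatum (L : Type) (e₁) (frameD V) (frameD_real V) (frameD_ne V) (lineVec (L : Type) (dW c.D 1))
    (fun _ => dW_real c.D 1) (fun _ => dW_ne c.D 1)).CompatibleSplitting)
  (hGR₂ : (cmSplittingDatum (L : Type) (e₁) (frameD V) (frameD_real V) (frameD_ne V) (lineVec (L : Type) (dW' c.D 0))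
    (fun _ => dW'_real c.D 0) (fun _ => dW'_ne c.D 0)).CompatibleSplitting)
  (hGR₃ : (cmSplittingDatum (L : Type) (e₁) (frameD V) (frameD_real V) (frameD_ne V) (lineVec (L : Type) (dW' c.D 1))
    (fun _ => dW'_real c.D 1) (fun _ => dW'_ne c.D 1)).CompatibleSplitting)
  (h₁W : (∀ j, 0 < (ι₁ (dW c.D j)).re) ∨ ∀ j, (ι₁ (dW c.D j)).re < 0)
  (hpos₀ : 0 < HypCensus.cmXW (L : Type) (frameD V) (lineVec (L : Type) (dW c.D 0)) (fun _ => dW_real c.D 0) ι₁ (HypCensus.cmPlace (L : Type) ι₁) 0)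
  (hpos₁ : 0 < HypCensus.cmXW (L : Type) (frameD V) (lineVec (L : Type) (dW c.D 1)) (fun _ => dW_real c.D 1) ι₁ (HypCensus.cmPlace (L : Type) ι₁) 0)
  (hpos₂ : 0 < HypCensus.cmXW (L : Type) (frameD V) (lineVec (L : Type) (dW' c.D 0)) (fun _ => dW'_real c.D 0) ι₁ (HypCensus.cmPlace (L : Type) ι₁) 0)
  (hpos₃ : 0 < HypCensus.cmXW (L : Type) (frameD V) (lineVec (L : Type) (dW' c.D 1)) (fun _ => dW'_real c.D 1) ι₁ (HypCensus.cmPlace (L : Type) ι₁) 0)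

/-- **`hΔ₁` FROM THE PLANE TORUS EIGEN-IDENTITY at (F1)'s slot vectors**: `slotTypeVec 1 − slotTypeVec 0 = m₁ − m₀`. -/
theorem slotTypeVec_sub_eq_of_planeTorus_eigen {N₀ N₁ : ℕ} (hN₀ : N₀ ≠ 0) (hN₁ : N₁ ≠ 0)
    (m₀ m₁ : NumberField.InfinitePlace (L : Type) → ℤ)
    (h : ∀ t₀ t₁ : ↥(relNormOneInfUnits (↥(NumberField.maximalRealSubfield (L : Type))) (L : Type)),
      cmPairRep (L : Type) finProdFinEquiv (frameD V) (frameD_real V) (frameD_ne V) (dW c.D) (dW_real c.D) (dW_ne c.D) hGR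
        (1, cmPlaneTorusIdeles (L : Type) (dW c.D)
          (relNormOneInfToIdeles (↥(NumberField.maximalRealSubfield (L : Type))) (L : Type) t₀,
            relNormOneInfToIdeles (↥(NumberField.maximalRealSubfield (L : Type))) (L : Type) t₁))
    (cmLineTensorFin (L : Type) finProdFinEquiv e₁ (frameD V) (frameD_real V) (frameD_ne V) (dW c.D) (dW_real c.D) (dW_ne c.D)
          (SupplyInstance.testFun (↥(NumberField.maximalRealSubfield (L : Type))) (Fin 3) (linePhi V (dW c.D 0) (dW_real c.D 0) (dW_ne c.D 0) hpos₀) (lineX₀ V (dW c.D 0) (dW_real c.D 0) (dW_ne c.D 0) hpos₀) N₀)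
          (SupplyInstance.testFun (↥(NumberField.maximalRealSubfield (L : Type))) (Fin 3) (linePhi V (dW c.D 1) (dW_real c.D 1) (dW_ne c.D 1) hpos₁) (lineX₀ V (dW c.D 1) (dW_real c.D 1) (dW_ne c.D 1) hpos₁) N₁)) =
      (archWeight (L : Type) m₀ t₀ * archWeight (L : Type) m₁ t₁) •
    (cmLineTensorFin (L : Type) finProdFinEquiv e₁ (frameD V) (frameD_real V) (frameD_ne V) (dW c.D) (dW_real c.D) (dW_ne c.D)
          (SupplyInstance.testFun (↥(NumberField.maximalRealSubfield (L : Type))) (Fin 3) (linePhi V (dW c.D 0) (dW_real c.D 0) (dW_ne c.D 0) hpos₀) (lineX₀ V (dW c.D 0) (dW_real c.D 0) (dW_ne c.D 0) hpos₀) N₀)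
          (SupplyInstance.testFun (↥(NumberField.maximalRealSubfield (L : Type))) (Fin 3) (linePhi V (dW c.D 1) (dW_real c.D 1) (dW_ne c.D 1) hpos₁) (lineX₀ V (dW c.D 1) (dW_real c.D 1) (dW_ne c.D 1) hpos₁) N₁))) :
    slotTypeVec V c hGR hGR₀ hGR₁ hGR₂ hGR₃ h₁W 1 - slotTypeVec V c hGR hGR₀ hGR₁ hGR₂ hGR₃ h₁W 0 = m₁ - m₀ :=
  slotType_sub_eq_of_planeTorus_eigen V c.D hGR hGR₀ hGR₁ (linePhi V (dW c.D 0) (dW_real c.D 0) (dW_ne c.D 0) hpos₀) (linePhi V (dW c.D 1) (dW_real c.D 1) (dW_ne c.D 1) hpos₁)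
    (lineX₀ V (dW c.D 0) (dW_real c.D 0) (dW_ne c.D 0) hpos₀) (lineX₀ V (dW c.D 1) (dW_real c.D 1) (dW_ne c.D 1) hpos₁) (lineCHom V (dW c.D 0) (dW_real c.D 0) (dW_ne c.D 0) hGR₀) (lineCHom V (dW c.D 1) (dW_real c.D 1) (dW_ne c.D 1) hGR₁)
    (fun N t => line_hctr V (dW c.D 0) (dW_real c.D 0) (dW_ne c.D 0) hGR₀ hpos₀ _ N t)
    (fun N t => line_hctr V (dW c.D 1) (dW_real c.D 1) (dW_ne c.D 1) hGR₁ hpos₁ _ N t)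
    (continuous_slotChi₀_mul_lineCHom V c.D hGR hGR₀ hGR₁ h₁W) (continuous_slotChi₁_mul_lineCHom V c.D hGR hGR₀ hGR₁ h₁W)
    (linePhi_archEmb_lineX₀_ne_zero V _ _ _ hpos₀) (linePhi_archEmb_lineX₀_ne_zero V _ _ _ hpos₁) hN₀ hN₁ m₀ m₁ h

/-- **`hΔ₂`, `hΔ₃` FROM THE TWO TORUS EIGEN-IDENTITIES at (F1)'s slot vectors**: with the plane identity fixing `m₀` and the
conjugated-plane identity fixing `m₂, m₃`: `slotTypeVec 2 − slotTypeVec 0 = m₂ − m₀`, `slotTypeVec 3 − slotTypeVec 0 = m₃ − m₀`. -/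
theorem slotTypeVec_sub_eq_of_conjPlaneTorus_eigen {N₀ N₁ N₂ N₃ : ℕ} (hN₀ : N₀ ≠ 0) (hN₁ : N₁ ≠ 0) (hN₂ : N₂ ≠ 0) (hN₃ : N₃ ≠ 0)
    (m₀ m₁ m₂ m₃ : NumberField.InfinitePlace (L : Type) → ℤ)
    (h : ∀ t₀ t₁ : ↥(relNormOneInfUnits (↥(NumberField.maximalRealSubfield (L : Type))) (L : Type)),
      cmPairRep (L : Type) finProdFinEquiv (frameD V) (frameD_real V) (frameD_ne V) (dW c.D) (dW_real c.D) (dW_ne c.D) hGR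
        (1, cmPlaneTorusIdeles (L : Type) (dW c.D)
          (relNormOneInfToIdeles (↥(NumberField.maximalRealSubfield (L : Type))) (L : Type) t₀,
            relNormOneInfToIdeles (↥(NumberField.maximalRealSubfield (L : Type))) (L : Type) t₁))
    (cmLineTensorFin (L : Type) finProdFinEquiv e₁ (frameD V) (frameD_real V) (frameD_ne V) (dW c.D) (dW_real c.D) (dW_ne c.D)
          (SupplyInstance.testFun (↥(NumberField.maximalRealSubfield (L : Type))) (Fin 3) (linePhi V (dW c.D 0) (dW_real c.D 0) (dW_ne c.D 0) hpos₀) (lineX₀ V (dW c.D 0) (dW_real c.D 0) (dW_ne c.D 0) hpos₀) N₀)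
          (SupplyInstance.testFun (↥(NumberField.maximalRealSubfield (L : Type))) (Fin 3) (linePhi V (dW c.D 1) (dW_real c.D 1) (dW_ne c.D 1) hpos₁) (lineX₀ V (dW c.D 1) (dW_real c.D 1) (dW_ne c.D 1) hpos₁) N₁)) =
      (archWeight (L : Type) m₀ t₀ * archWeight (L : Type) m₁ t₁) •
    (cmLineTensorFin (L : Type) finProdFinEquiv e₁ (frameD V) (frameD_real V) (frameD_ne V) (dW c.D) (dW_real c.D) (dW_ne c.D)
          (SupplyInstance.testFun (↥(NumberField.maximalRealSubfield (L : Type))) (Fin 3) (linePhi V (dW c.D 0) (dW_real c.D 0) (dW_ne c.D 0) hpos₀) (lineX₀ V (dW c.D 0) (dW_real c.D 0) (dW_ne c.D 0) hpos₀) N₀)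
          (SupplyInstance.testFun (↥(NumberField.maximalRealSubfield (L : Type))) (Fin 3) (linePhi V (dW c.D 1) (dW_real c.D 1) (dW_ne c.D 1) hpos₁) (lineX₀ V (dW c.D 1) (dW_real c.D 1) (dW_ne c.D 1) hpos₁) N₁)))
    (h' : ∀ t₀ t₁ : ↥(relNormOneInfUnits (↥(NumberField.maximalRealSubfield (L : Type))) (L : Type)),
      cmPairRep (L : Type) finProdFinEquiv (frameD V) (frameD_real V) (frameD_ne V) (dW c.D) (dW_real c.D) (dW_ne c.D) hGR
        (1, cmConjPlaneTorusIdeles (L : Type) (dW c.D) (dW' c.D) c.D.isoGL (isoGL_hg₀ c.D)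
          (relNormOneInfToIdeles (↥(NumberField.maximalRealSubfield (L : Type))) (L : Type) t₀,
            relNormOneInfToIdeles (↥(NumberField.maximalRealSubfield (L : Type))) (L : Type) t₁))
    (cmConjLineTensorFin (L : Type) finProdFinEquiv e₁ (frameD V) (frameD_real V) (frameD_ne V) (dW c.D) (dW_real c.D) (dW_ne c.D)
          (dW' c.D) (dW'_real c.D) (dW'_ne c.D) c.D.isoGL (isoGL_hg₀ c.D)
          (SupplyInstance.testFun (↥(NumberField.maximalRealSubfield (L : Type))) (Fin 3) (linePhi V (dW' c.D 0) (dW'_real c.D 0) (dW'_ne c.D 0) hpos₂) (lineX₀ V (dW' c.D 0) (dW'_real c.D 0) (dW'_ne c.D 0) hpos₂) N₂)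
          (SupplyInstance.testFun (↥(NumberField.maximalRealSubfield (L : Type))) (Fin 3) (linePhi V (dW' c.D 1) (dW'_real c.D 1) (dW'_ne c.D 1) hpos₃) (lineX₀ V (dW' c.D 1) (dW'_real c.D 1) (dW'_ne c.D 1) hpos₃) N₃)) =
      (archWeight (L : Type) m₂ t₀ * archWeight (L : Type) m₃ t₁) •
    (cmConjLineTensorFin (L : Type) finProdFinEquiv e₁ (frameD V) (frameD_real V) (frameD_ne V) (dW c.D) (dW_real c.D) (dW_ne c.D)
          (dW' c.D) (dW'_real c.D) (dW'_ne c.D) c.D.isoGL (isoGL_hg₀ c.D)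
          (SupplyInstance.testFun (↥(NumberField.maximalRealSubfield (L : Type))) (Fin 3) (linePhi V (dW' c.D 0) (dW'_real c.D 0) (dW'_ne c.D 0) hpos₂) (lineX₀ V (dW' c.D 0) (dW'_real c.D 0) (dW'_ne c.D 0) hpos₂) N₂)
          (SupplyInstance.testFun (↥(NumberField.maximalRealSubfield (L : Type))) (Fin 3) (linePhi V (dW' c.D 1) (dW'_real c.D 1) (dW'_ne c.D 1) hpos₃) (lineX₀ V (dW' c.D 1) (dW'_real c.D 1) (dW'_ne c.D 1) hpos₃) N₃))) :
    slotTypeVec V c hGR hGR₀ hGR₁ hGR₂ hGR₃ h₁W 2 - slotTypeVec V c hGR hGR₀ hGR₁ hGR₂ hGR₃ h₁W 0 = m₂ - m₀ ∧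
      slotTypeVec V c hGR hGR₀ hGR₁ hGR₂ hGR₃ h₁W 3 - slotTypeVec V c hGR hGR₀ hGR₁ hGR₂ hGR₃ h₁W 0 = m₃ - m₀ :=
  slotType_sub_eq_of_conjPlaneTorus_eigen V c.D hGR hGR₂ hGR₃ (linePhi V (dW' c.D 0) (dW'_real c.D 0) (dW'_ne c.D 0) hpos₂) (linePhi V (dW' c.D 1) (dW'_real c.D 1) (dW'_ne c.D 1) hpos₃)
    (lineX₀ V (dW' c.D 0) (dW'_real c.D 0) (dW'_ne c.D 0) hpos₂) (lineX₀ V (dW' c.D 1) (dW'_real c.D 1) (dW'_ne c.D 1) hpos₃) (lineCHom V (dW' c.D 0) (dW'_real c.D 0) (dW'_ne c.D 0) hGR₂) (lineCHom V (dW' c.D 1) (dW'_real c.D 1) (dW'_ne c.D 1) hGR₃)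
    (fun N t => line_hctr V (dW' c.D 0) (dW'_real c.D 0) (dW'_ne c.D 0) hGR₂ hpos₂ _ N t)
    (fun N t => line_hctr V (dW' c.D 1) (dW'_real c.D 1) (dW'_ne c.D 1) hGR₃ hpos₃ _ N t)
    (continuous_slotChi₂_mul_lineCHom V c.D hGR hGR₂ hGR₃ h₁W) (continuous_slotChi₃_mul_lineCHom V c.D hGR hGR₂ hGR₃ h₁W)
    (linePhi_archEmb_lineX₀_ne_zero V _ _ _ hpos₂) (linePhi_archEmb_lineX₀_ne_zero V _ _ _ hpos₃) hN₂ hN₃ m₂ m₃ h'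
    (continuous_slotChi₀_mul_lineCHom V c.D hGR hGR₀ hGR₁ h₁W)
    (slotType_eq_of_planeTorus_eigen V c.D hGR hGR₀ hGR₁ (linePhi V (dW c.D 0) (dW_real c.D 0) (dW_ne c.D 0) hpos₀) (linePhi V (dW c.D 1) (dW_real c.D 1) (dW_ne c.D 1) hpos₁)
      (lineX₀ V (dW c.D 0) (dW_real c.D 0) (dW_ne c.D 0) hpos₀) (lineX₀ V (dW c.D 1) (dW_real c.D 1) (dW_ne c.D 1) hpos₁) (lineCHom V (dW c.D 0) (dW_real c.D 0) (dW_ne c.D 0) hGR₀) (lineCHom V (dW c.D 1) (dW_real c.D 1) (dW_ne c.D 1) hGR₁)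
      (fun N t => line_hctr V (dW c.D 0) (dW_real c.D 0) (dW_ne c.D 0) hGR₀ hpos₀ _ N t)
      (fun N t => line_hctr V (dW c.D 1) (dW_real c.D 1) (dW_ne c.D 1) hGR₁ hpos₁ _ N t)
      (continuous_slotChi₀_mul_lineCHom V c.D hGR hGR₀ hGR₁ h₁W) (continuous_slotChi₁_mul_lineCHom V c.D hGR hGR₀ hGR₁ h₁W)
      (linePhi_archEmb_lineX₀_ne_zero V _ _ _ hpos₀) (linePhi_archEmb_lineX₀_ne_zero V _ _ _ hpos₁) hN₀ hN₁ m₀ m₁ h).1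

end Vec

end HodgeCM.Model.ArchSideTerm

end
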